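import Literature.AnabelianGeometry.EtaleTheta.Discharge.Sec2CompletionIndex
import Literature.AnabelianGeometry.EtaleTheta.Discharge.Sec2CompletionNormal

/-!
# The PROFINITE `Π`-level degrees and normality of `X̲̲ → X̲ → X` in the §1 model:
# `[Π_X : Π_X̲] = l`, `[Π_X : Π_X̲̲] = l²`, `[Π_X̲ : Π_X̲̲] = l`, `Π_X̲ ⊴ Π_X`, and `Π_X̲̲ ⊴ Π_X̲` from the tempered one

Mochizuki, *The étale theta function …* [EtTh], Publ. RIMS **45** (2009), §2: Def. 2.1 / Rmk. 2.1.1 PRIMS PDF p. 36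
("`X̲ → X` is [by construction] Galois, with `Gal(X̲/X) ≅ Q`", `Q` free of rank one over `ℤ/lℤ`), Rmk. 2.3.1 p. 38
("extracting two copies of `ℤ/lℤ`"), Def. 2.5 (i) p. 39 (the PROFINITE open subgroups `Π_X̲̲ ⊆ Π_X̲ ⊆ Π_X` corresponding
to the tempered ones) [cite: MochizukiEtTh2009, Rmk 2.3.1 p.38]. PROOF-ONLY (0 definitions; cell abc-iut, layer L2,
seat abc-iut-L2-t8; sequel of `Sec2CompletionIndex.lean` / `Sec2CompletionNormal.lean`, for the `Π`-level carriers
`hat := Π_X̲̲ ⊆ pmHat := Π_X̲ ⊆ Π_X` of abc-iut-L6-t19's ±-tower cover model).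

With `Π_X := D.PiHat` the profinite completion of `Π^tp_X` (root field `isProfiniteCompletion_toHat`) and `Π̂_X̲`, `Π̂_X̲̲`
the CLOSURES in `Π_X` of the images of `Π^tp_X̲ = D.GtpXu l` (abc-iut-L2-t7) and `Π^tp_X̲̲ = C.Huu` (abc-iut-L2-t8's
`DoubleUnderline`) under `toHat`:
* `ThetaSetting.index_closure_GtpXu` — `[Π_X : Π̂_X̲] = l` (from abc-iut-L2-t7's tempered `index_GtpXu`);
* `ThetaSetting.normal_closure_GtpXu` — `Π̂_X̲ ⊴ Π_X` ("`X̲ → X` is Galois": `Π^tp_X̲ ⊴ Π^tp_X` + density);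
* `DoubleUnderline.index_closure_Huu` — `[Π_X : Π̂_X̲̲] = l²` (tempered `index_Huu`); `relIndex_closure_Huu_closure_GtpXu`
  — `[Π̂_X̲ : Π̂_X̲̲] = l` (tempered `relIndex_Huu_GtpXu`);
* `DoubleUnderline.normal_closure_Huu_subgroupOf_closure_GtpXu` — `Π̂_X̲̲ ⊴ Π̂_X̲` GIVEN the tempered normality
  `Π^tp_X̲̲ ⊴ Π^tp_X̲` (hypothesis `hN`; a theorem for abc-iut-L2-t7's cocycle model under `μ_l ⊆ K`, p422309 — it is
  NOT derivable for the abstract `DoubleUnderline`, [IUTchI] Def. 3.1 (c) being the printed source of `μ_l ⊆ K`).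
All from the generic `IsProfiniteCompletion.index_topologicalClosure_map` / `Subgroup.normal_subgroupOf_topologicalClosure_map`.
Honest framing: bookkeeping; the structures are data quoting print; no side is taken on [IUTchIII] Cor. 3.12.
-/

noncomputable section

namespace Literature.AnabelianGeometry.EtaleTheta

open Literature.AnabelianGeometry.SemiGraphs

namespace ThetaSetting

variable {p : ℕ} [Fact p.Prime] {D : ThetaSetting p} (l : ℕ)

/-- `Π^tp_X̲` has finite index `l` in `Π^tp_X` when `l ≠ 0` (abc-iut-L2-t7's `index_GtpXu`).
[cite: MochizukiEtTh2009, Def 2.1 p.36] -/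
theorem finiteIndex_GtpXu (hl : l ≠ 0) : (D.GtpXu l).FiniteIndex :=
  ⟨by rw [D.index_GtpXu l]; exact hl⟩

/-- **`[Π_X : Π̂_X̲] = l`**: the closure in the profinite completion `Π_X` of the image of `Π^tp_X̲` has index `l`
(`l ≠ 0`; the profinite "`Gal(X̲/X) ≅ ℤ/lℤ`", Rmk. 2.1.1). [cite: MochizukiEtTh2009, Rmk 2.1.1 p.36] -/
theorem index_closure_GtpXu (hl : l ≠ 0) :
    (((D.GtpXu l).map D.toHat.toMonoidHom).topologicalClosure).index = l := by
  haveI := D.finiteIndex_GtpXu l hl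
  rw [IsProfiniteCompletion.index_topologicalClosure_map D.isProfiniteCompletion_toHat _ (D.isOpen_GtpXu l)]
  exact D.index_GtpXu l

/-- The closure of the image of ALL of `Π^tp_X` is all of `Π_X` (dense range).
[cite: MochizukiSemiAnbd2006, §6 p.69] -/
theorem topologicalClosure_map_toHat_top : ((⊤ : Subgroup D.PiTemp).map D.toHat.toMonoidHom).topologicalClosure = ⊤ := by
  rw [eq_top_iff]
  intro x _
  have hx : x ∈ closure (Set.range (D.toHat : D.PiTemp → D.PiHat)) :=
    D.isProfiniteCompletion_toHat.denseRange.closure_range ▸ Set.mem_univ x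
  have h : Set.range (D.toHat : D.PiTemp → D.PiHat) = (((⊤ : Subgroup D.PiTemp).map D.toHat.toMonoidHom :
      Subgroup D.PiHat) : Set D.PiHat) := by
    ext y
    simp only [Set.mem_range, Subgroup.coe_map, Subgroup.coe_top, Set.image_univ]
    rfl
  rw [h, ← Subgroup.topologicalClosure_coe] at hx
  exact hx

/-- **`Π̂_X̲ ⊴ Π_X`** ("`X̲ → X` is [by construction] Galois", Rmk. 2.1.1): `Π^tp_X̲ ⊴ Π^tp_X` (abc-iut-L2-t7's
`GtpXu_normal`) and normality survives closure of images (`Subgroup.normal_subgroupOf_topologicalClosure_map`)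
relative to the dense image of `Π^tp_X`. [cite: MochizukiEtTh2009, Rmk 2.1.1 p.36] -/
theorem normal_closure_GtpXu : (((D.GtpXu l).map D.toHat.toMonoidHom).topologicalClosure).Normal := by
  haveI : ((D.GtpXu l).subgroupOf (⊤ : Subgroup D.PiTemp)).Normal := inferInstance
  have h := Subgroup.normal_subgroupOf_topologicalClosure_map D.toHat.toMonoidHom
    (le_top : D.GtpXu l ≤ ⊤) this
  rw [D.topologicalClosure_map_toHat_top, Subgroup.normal_subgroupOf_iff le_top] at h
  exact ⟨fun a ha g => h a g ha (Subgroup.mem_top g)⟩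

namespace EtaleThetaData.DoubleUnderline

variable {E : D.EtaleThetaData} {l} (C : E.DoubleUnderline l)

/-- `Π^tp_X̲̲` has finite index `l²` in `Π^tp_X` (abc-iut-L2-t7's `index_Huu`; `l ≠ 0` from `l` odd) — a private copy
of abc-iut-L2-t2's `DoubleUnderline.finiteIndex_Huu` (`ThetaRootOrbitsOfSetting.lean`), to keep this file's imports light.
[cite: MochizukiEtTh2009, Rmk 2.3.1 p.38] -/
private theorem finiteIndex_Huu' : C.Huu.FiniteIndex :=
  ⟨by rw [C.index_Huu]; exact pow_ne_zero 2 C.l_ne_zero⟩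

/-- **`[Π_X : Π̂_X̲̲] = l²`** (profinite form of "extracting two copies of `ℤ/lℤ`", Rmk. 2.3.1).
[cite: MochizukiEtTh2009, Rmk 2.3.1 p.38] -/
theorem index_closure_Huu : ((C.Huu.map D.toHat.toMonoidHom).topologicalClosure).index = l ^ 2 := by
  haveI := finiteIndex_Huu' C
  rw [IsProfiniteCompletion.index_topologicalClosure_map D.isProfiniteCompletion_toHat _ C.isOpen_Huu]
  exact C.index_Huu

/-- **`[Π̂_X̲ : Π̂_X̲̲] = l`** (profinite form of "`X̲̲ → X̲` extracts the second copy of `ℤ/lℤ`", Rmk. 2.3.1;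
tempered `relIndex_Huu_GtpXu`). [cite: MochizukiEtTh2009, Rmk 2.3.1 p.38] -/
theorem relIndex_closure_Huu_closure_GtpXu :
    ((C.Huu.map D.toHat.toMonoidHom).topologicalClosure).relIndex
        (((D.GtpXu l).map D.toHat.toMonoidHom).topologicalClosure) = l := by
  haveI := finiteIndex_Huu' C
  haveI := D.finiteIndex_GtpXu l C.l_ne_zero
  rw [IsProfiniteCompletion.relIndex_topologicalClosure_map D.isProfiniteCompletion_toHat _ _ C.isOpen_Huu
    (D.isOpen_GtpXu l) C.Huu_le_GtpXu]
  exact C.relIndex_Huu_GtpXu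

/-- **`Π̂_X̲̲ ⊴ Π̂_X̲` from the tempered normality** `Π^tp_X̲̲ ⊴ Π^tp_X̲` (hypothesis `hN` — in print it holds
because `μ_l ⊆ K`, [IUTchI] Def. 3.1 (c); in the tree it is abc-iut-L2-t7's theorem for the cocycle model of `X̲̲`
under that hypothesis, p422309, and is not derivable for the abstract `DoubleUnderline`).
[cite: MochizukiEtTh2009, Prop 2.2 (ii) p.37] -/
theorem normal_closure_Huu_subgroupOf_closure_GtpXu (hN : (C.Huu.subgroupOf (D.GtpXu l)).Normal) :
    (((C.Huu.map D.toHat.toMonoidHom).topologicalClosure).subgroupOf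
      (((D.GtpXu l).map D.toHat.toMonoidHom).topologicalClosure)).Normal :=
  Subgroup.normal_subgroupOf_topologicalClosure_map D.toHat.toMonoidHom C.Huu_le_GtpXu hN

end EtaleThetaData.DoubleUnderline

end ThetaSetting

end Literature.AnabelianGeometry.EtaleTheta
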